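import Summits.AnomalousDissipation.AnomalousDissipation.Theorems.GenericRunawayStokesScaling.Negative.Frame

/-!
# Negative knowledge for the crux `MirrorVariety.GenericRunawayStokesScaling` (stmt-AnomalousDissipation-2990), V:
# the degenerate resolutions `N = 0` (vacuous) and `N = 1` (TRUE, sharp)

Certified copy of §3 of the cdisprove work file.  `PB_zero`, `crux_at_N0`: at `N = 0` the punctured ball is empty
and every force vector is `0`, so the hypothesis `g ≠ 0` fails.  `no_triads_N1`, `convectionCoeff_N1`: the
punctured unit ball carries no triad, the `N = 1` Galerkin field is the linear Stokes field (`galerkinRHS_N1`),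
the variety is the Stokes hyperbola and its mirror (`variety_N1`), and the crux's conclusion holds with the SHARP
constant `ν²‖c‖² ≡ ‖g‖²/(4π²)²` without any regularity hypothesis (`stokesRate_N1`, `crux_at_N1`) — tightness of
the upper bound `sq_mul_norm_sq_le` of part I.  The arena of the crux is `N ≥ 2`.  Supports stmt-AnomalousDissipation-2990.
-/

set_option linter.dupNamespace false

noncomputable section

open scoped BigOperators InnerProductSpace ComplexConjugate
open Filter Set Function

namespace Summit.AnomalousDissipation.AnomalousDissipation.Theorems.GenericRunawayStokesScaling.Negative

open Literature.Analysis.FunctionSpaces Literature.Analysis.FunctionSpaces.Torus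
open Literature.Analysis.FluidPDE Literature.Analysis.FluidPDE.Torus
open Summit.AnomalousDissipation.AnomalousDissipation.Theses.MirrorVariety

/-! ## §3 Degenerate resolutions: `N = 0` (vacuous) and `N = 1` (true, no triads) -/

/-- At `N = 0` the punctured ball is empty. [folklore] -/
theorem PB_zero : PB 0 = ∅ := by
  ext k
  simp only [Finset.notMem_empty, iff_false]
  intro hk
  rw [mem_PB_iff] at hk
  have := one_le_sum_sq_of_ne_zero hk.1
  simp at hk
  omega

/-- At `N = 0` every coefficient vector is zero, so the hypothesis `g ≠ 0` fails: the crux holds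
VACUOUSLY at resolution `0`. [folklore] -/
theorem crux_at_N0 (g : ↥(PB 0) → (EuclideanSpace ℂ (Fin 3))) : g = 0 := by
  funext k
  exact absurd k.2 (Finset.eq_empty_iff_forall_notMem.1 PB_zero _)

/-- **No triads in the punctured unit ball**: for `k, l, m ∈ S_1`, `l + m ≠ k`
(`|l|² = |m|² = |k|² = 1` and `|l+m|² = 2 + 2 l·m` is even). [folklore] -/
theorem no_triads_N1 {k l m : Fin 3 → ℤ} (hk : k ∈ PB 1) (hl : l ∈ PB 1) (hm : m ∈ PB 1) :
    l + m ≠ k := by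
  intro h
  rw [mem_PB_iff] at hk hl hm
  have hk1 := one_le_sum_sq_of_ne_zero hk.1
  have hl1 := one_le_sum_sq_of_ne_zero hl.1
  have hm1 := one_le_sum_sq_of_ne_zero hm.1
  have hsum := sum_sq_add l m
  rw [h] at hsum
  simp only [Nat.cast_one, one_pow] at hk hl hm
  omega

/-- Hence the convection symbol vanishes identically on `S_1`: the `N = 1` Galerkin system is the
linear Stokes system. [folklore] -/
theorem convectionCoeff_N1 (c c' : (Fin 3 → ℤ) → (EuclideanSpace ℂ (Fin 3))) {k : Fin 3 → ℤ} (hk : k ∈ PB 1) :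
    convectionCoeff (PB 1) c c' k = 0 := by
  rw [convectionCoeff_def]
  refine Finset.sum_eq_zero fun l hl => Finset.sum_eq_zero fun m hm => ?_
  rw [if_neg (no_triads_N1 hk hl hm)]

/-- On `S_1` every frequency has `|k|² = 1`. [folklore] -/
theorem freqNormSq_N1 {k : Fin 3 → ℤ} (hk : k ∈ PB 1) : freqNormSq k = 1 := by
  rw [mem_PB_iff] at hk
  have h1 := one_le_sum_sq_of_ne_zero hk.1
  simp only [Nat.cast_one, one_pow] at hk
  rw [freqNormSq_eq_intCast]
  have : (∑ i, k i ^ 2 : ℤ) = 1 := le_antisymm hk.2 h1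
  rw [this]; simp

/-- **The `N = 1` Galerkin field is the Stokes field** `F(c, ν)_k = -4π²ν c_k + g_k` for `g` in the
Galerkin space. [folklore] -/
theorem galerkinRHS_N1 (ν : ℝ) {g : ↥(PB 1) → (EuclideanSpace ℂ (Fin 3))} (hg : g ∈ galerkinSubspace (PB 1))
    (c : ↥(PB 1) → (EuclideanSpace ℂ (Fin 3))) (k : ↥(PB 1)) :
    galerkinRHS (PB 1) ν g c k = -(((4 * Real.pi ^ 2 * ν : ℝ) : ℂ) • c k) + g k := by
  rw [galerkinRHS_apply, galerkinField_def, convectionCoeff_N1 _ _ k.2, sub_zero, coeffExt_coe,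
    coeffExt_coe, leraySym_apply_of_mem hg, freqNormSq_N1 k.2, mul_one, mul_comm ν]

/-- **Zeros at `N = 1`**: `(c, ν) ∈ V_1(g)` with `g ≠ 0` forces `ν ≠ 0` and `c = (4π²ν)⁻¹ g`
(the Stokes hyperbola and its mirror; nothing else). [folklore] -/
theorem variety_N1 {g : ↥(PB 1) → (EuclideanSpace ℂ (Fin 3))} (hg : g ∈ galerkinSubspace (PB 1)) (hg0 : g ≠ 0)
    {z : (↥(PB 1) → (EuclideanSpace ℂ (Fin 3))) × ℝ} (hz : z ∈ variety (PB 1) g) :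
    z.2 ≠ 0 ∧ z.1 = (4 * Real.pi ^ 2 * z.2)⁻¹ • g := by
  have hF : ∀ k, (((4 * Real.pi ^ 2 * z.2 : ℝ) : ℂ) • z.1 k) = g k := by
    intro k
    have := congrFun hz.2 k
    rw [galerkinRHS_N1 z.2 hg z.1 k, Pi.zero_apply, neg_add_eq_zero] at this
    exact this
  have hν : z.2 ≠ 0 := by
    intro h0
    apply hg0
    funext k
    rw [← hF k, h0]
    simp
  refine ⟨hν, ?_⟩
  have hne : ((4 * Real.pi ^ 2 * z.2 : ℝ) : ℂ) ≠ 0 := by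
    rw [Complex.ofReal_ne_zero]; positivity
  rw [real_smul_coeff]
  funext k
  rw [Pi.smul_apply, ← hF k, smul_smul, Complex.ofReal_inv, inv_mul_cancel₀ hne, one_smul]

/-- **The crux HOLDS at `N = 1`, with the sharp constant and WITHOUT the regularity hypothesis**:
every zero has `ν²‖c‖² = ‖g‖²/(4π²)²` exactly (tightness: the Stokes rate is attained identically).
[folklore] -/
theorem stokesRate_N1 {g : ↥(PB 1) → (EuclideanSpace ℂ (Fin 3))} (hg : g ∈ galerkinSubspace (PB 1)) (hg0 : g ≠ 0) :
    ∀ z ∈ variety (PB 1) g, z.2 ^ 2 * ‖z.1‖ ^ 2 = (‖g‖ / (4 * Real.pi ^ 2)) ^ 2 := by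
  intro z hz
  obtain ⟨hν, hc⟩ := variety_N1 hg hg0 hz
  rw [hc, norm_smul, Real.norm_eq_abs, abs_inv, mul_pow, inv_pow, sq_abs]
  have hpos : 0 < 4 * Real.pi ^ 2 := by positivity
  field_simp

/-- Corollary: the `N = 1` instance of the crux (conclusion `StokesRate`), unconditionally in the
regularity hypothesis. [folklore] -/
theorem crux_at_N1 {g : ↥(PB 1) → (EuclideanSpace ℂ (Fin 3))} (hg : g ∈ galerkinSubspace (PB 1)) (hg0 : g ≠ 0) :
    StokesRate (PB 1) g := by
  refine ⟨0, (‖g‖ / (4 * Real.pi ^ 2)) ^ 2, ?_, fun z hz _ => (stokesRate_N1 hg hg0 z hz).ge⟩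
  have : 0 < ‖g‖ := norm_pos_iff.2 hg0
  positivity



end Summit.AnomalousDissipation.AnomalousDissipation.Theorems.GenericRunawayStokesScaling.Negative
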